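import Literature.Probability.LatticeModels.IsoradialDual
import Literature.Probability.Percolation.RhombicTilingPlanarity
import HarnessLib

/-!
# The dual isoradial graph is locally finite

For an isoradial rhombic tiling with bounded angles in which every vertex has a neighbour
(`IsIsoradial`, `IsRhombicTiling`, `HasBoundedAngles ε`, `0 < ε`; e.g. a preconnected graph with
an edge), and `G` locally finite, every face is adjacent in the dual graph `G*`
(`RhombicEmbedding.dualGraph`, `Literature.Probability.LatticeModels.IsoradialDual`) to only
finitely many faces: the darts having a given face `f` on their left or right start at vertices
at distance `1` from `c f`, and a bounded region contains finitely many vertices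
(`IsoradialCriticality.finite_setOf_boxNorm_le`, Grimmett–Manolescu 2014, §4.4 Prop. 7,
equivalence of metrics), each of finite degree.

* `finite_setOf_dart_face` — finitely many darts have a given face;
* `finite_neighborSet_dualGraph`, `locallyFiniteDualGraph` (a `Fintype` structure on each
  neighbour set of `G*`; a `def`, the finiteness being non-constructive).

## References

* G. R. Grimmett, I. Manolescu, *Bond percolation on isoradial graphs*, PTRF 159 (2014),
  arXiv:1204.0505, §4.1 (the dual graph), §4.4 Prop. 7 (equivalence of metrics).
-/

noncomputable section

namespace Literature.Probability.Percolation

open Literature.Probability.LatticeModels Literature.Probability.LatticeModels.RhombicEmbedding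

variable {V F : Type*} {G : SimpleGraph V} {emb : RhombicEmbedding G F}

/-- The darts at the vertices of a finite set of a locally finite graph form a finite set.
[folklore] -/
theorem finite_setOf_dart_fst_mem [G.LocallyFinite] {S : Set V} (hS : S.Finite) :
    {d : G.Dart | d.fst ∈ S}.Finite := by
  have h : {d : G.Dart | d.fst ∈ S} ⊆ ⋃ v ∈ S, Set.range (G.dartOfNeighborSet v) := by
    intro d hd
    refine Set.mem_iUnion₂.2 ⟨d.fst, hd, ⟨d.snd, d.adj⟩, ?_⟩
    ext <;> rfl
  exact (hS.biUnion fun v _ => Set.finite_range _).subset h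

/-- **Finitely many darts have a given face** (on their left or on their right): their tails lie
on the unit circle about the face centre. [cite: GrimmettManolescu2014Isoradial, §4.4 Prop. 7 (equivalence of metrics)] -/
theorem finite_setOf_dart_face [G.LocallyFinite] {ε : ℝ} (hiso : emb.IsIsoradial)
    (hrh : emb.IsRhombicTiling) (hbap : emb.HasBoundedAngles ε) (hε : 0 < ε)
    (hnb : ∀ v : V, ∃ u, G.Adj v u) (f : F) :
    {d : G.Dart | emb.leftFace d = f ∨ emb.rightFace d = f}.Finite := by
  have hfin := IsoradialCriticality.finite_setOf_boxNorm_le hiso hrh hbap hε hnb (emb.c f) 1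
  refine (finite_setOf_dart_fst_mem hfin).subset fun d hd => ?_
  simp only [Set.mem_setOf_eq] at hd ⊢
  have h1 : ‖emb.z d.fst - emb.c f‖ = 1 := by
    rcases hd with rfl | rfl
    · exact (hiso.norm_sub_eq_one d).1
    · exact norm_z_fst_sub_c_rightFace hiso d
  exact (IsoradialCriticality.boxNorm_le_norm _).trans h1.le

/-- **Every face has finitely many neighbours in the dual graph.**
[cite: GrimmettManolescu2014Isoradial, §4.1 (the dual graph) and §4.4 Prop. 7] -/
theorem finite_neighborSet_dualGraph [G.LocallyFinite] {ε : ℝ} (hiso : emb.IsIsoradial)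
    (hrh : emb.IsRhombicTiling) (hbap : emb.HasBoundedAngles ε) (hε : 0 < ε)
    (hnb : ∀ v : V, ∃ u, G.Adj v u) (f : F) : (emb.dualGraph.neighborSet f).Finite := by
  have hD := finite_setOf_dart_face hiso hrh hbap hε hnb f
  have h : emb.dualGraph.neighborSet f ⊆
      (fun d => emb.rightFace d) '' {d : G.Dart | emb.leftFace d = f ∨ emb.rightFace d = f} ∪
      (fun d => emb.leftFace d) '' {d : G.Dart | emb.leftFace d = f ∨ emb.rightFace d = f} := by
    intro g hg
    rw [SimpleGraph.mem_neighborSet, dualGraph_adj] at hg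
    obtain ⟨-, ⟨d, h1, h2⟩ | ⟨d, h1, h2⟩⟩ := hg
    · exact Or.inl ⟨d, Or.inl h1, h2⟩
    · exact Or.inr ⟨d, Or.inr h2, h1⟩
  exact ((hD.image _).union (hD.image _)).subset h

/-- **The dual graph is locally finite** (a `Fintype` structure on every neighbour set, obtained
non-constructively from `finite_neighborSet_dualGraph`). [cite: GrimmettManolescu2014Isoradial, §4.1 (the dual graph) and §4.4 Prop. 7] -/
abbrev locallyFiniteDualGraph [G.LocallyFinite] {ε : ℝ} (hiso : emb.IsIsoradial)
    (hrh : emb.IsRhombicTiling) (hbap : emb.HasBoundedAngles ε) (hε : 0 < ε)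
    (hnb : ∀ v : V, ∃ u, G.Adj v u) : emb.dualGraph.LocallyFinite := fun f =>
  (finite_neighborSet_dualGraph hiso hrh hbap hε hnb f).fintype

end Literature.Probability.Percolation

end
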